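import Summits.AtomisticToContinuum.BoseEinsteinCondensation.Theorems.BECHardSphereReductionHardSphereBECRetentionReductions
import Summits.AtomisticToContinuum.BoseEinsteinCondensation.Theorems.BECHardSphereReductionHardCoreDominatesDiniReduction
import Summits.AtomisticToContinuum.BoseEinsteinCondensation.Theorems.BECHardSphereReductionHardCoreDominatesOfDiniSign
import HarnessLib

/-!
# Route BECHardSphereReduction — the third source of per-ratio RETENTION: uniform dilute BEC;
# and retention from the Dini sign of crux `HardCoreDominates` (crux `HardSphereBEC`, stmt-11885, line `registered`, stub S2')

Sequel of `Theorems/BECHardSphereReductionHardSphereBECRetentionReductions.lean` (p157278, lead c6).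
Write `cn(N, L) := condensateNumber HS₁ N L`.  The registered stub `stub_perRatioRetention` (S2') of
`Cruxes/HardSphereBEC/Lines/birth.lean` asks, for the ratios `a` of some open interval
`(lo, hi) ⊂ (0,1)`, for `cn(N, L) ≤ K(a) · cn(N, L/a)` once `N ≥ N₀(a)` and `N ≤ η₀(a) L³`.
Lead c6 recorded two sources (per-ratio box monotonicity, hence items 11886 / 11884).  This file
adds the two remaining book-keeping facts about S2', so that its closure map is complete in Lean:

* `perRatioRetention_of_uniformDiluteBEC` — **any UNIFORM dilute BEC bound gives S2'** (with
  `K = 1/c`, on every interval of ratios): if `ofReal (c N) ≤ cn(N, L)` whenever `N ≥ N₀` and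
  `N ≤ η₀ L³`, then `cn(N, L) ≤ N = (1/c)·(cN) ≤ (1/c)·cn(N, L/a)`, the dilute guard passing to
  the bigger box `L/a ≥ L`.  So the second input of the line need not be a comparison statement at
  all; conversely S2' is NOT implied by the crux itself (whose BEC constants may degenerate as the
  density varies) — only by BEC with constants uniform on an initial interval of densities.
* `perRatioRetention_of_diniSign` — **S2' from the ONE open stub of crux 11884's line**: the Dini-form
  covariance sign `stub_diniSign` of `Cruxes/HardCoreDominates/Lines/birth.lean` gives
  `HardCoreDominates` (`hardCoreDominates_of_diniSign`, landed) and hence S2'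
  (`perRatioRetention_of_hardCoreDominates`, p157278).  Closure map of the line after lead c7:
  crux ⟸ S1 ∧ S2';  S1 ⟸ 11888;  S2' ⟸ 11886 | 11884 | uniform dilute BEC;  11884 ⟸ stub_diniSign.
-/

noncomputable section

namespace Summit.AtomisticToContinuum.BoseEinsteinCondensation.Cruxes.HardSphereBEC

open MeasureTheory ENNReal Filter Literature.MathematicalPhysics.QuantumManyBody.BoseGas
open Summit.AtomisticToContinuum.BoseEinsteinCondensation.Theses.BECHardSphereReduction
open Summit.AtomisticToContinuum.BoseEinsteinCondensation.Theorems

/-- **Uniform dilute BEC of unit hard spheres gives per-ratio retention** (`K := 1/c`,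
`N₀ := max N₀ 1`, any interval of ratios, here `(1/4, 1/2)`): inside the dilute window
`cn(N, L) ≤ N ≤ (1/c) · cn(N, L/a)` because the bigger box `L/a ≥ L` is dilute as well.
[folklore] -/
theorem perRatioRetention_of_uniformDiluteBEC
    (h : ∃ (N₀ : ℕ) (η₀ c : ℝ), 0 < η₀ ∧ 0 < c ∧ ∀ (N : ℕ) (L : ℝ), N₀ ≤ N → (N : ℝ) ≤ η₀ * L ^ 3 →
      ENNReal.ofReal (c * N) ≤
        condensateNumber (Set.indicator (Set.Iic 1) (fun _ : ℝ => (⊤ : ENNReal))) N L) :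
    ∃ lo hi : ℝ, 0 < lo ∧ lo < hi ∧ hi < 1 ∧ ∀ a : ℝ, lo < a → a < hi → ∃ (N₀ : ℕ) (η₀ K : ℝ), 0 < η₀ ∧ 0 < K ∧ ∀ (N : ℕ) (L : ℝ), N₀ ≤ N → (N : ℝ) ≤ η₀ * L ^ 3 → Literature.MathematicalPhysics.QuantumManyBody.BoseGas.condensateNumber (Set.indicator (Set.Iic 1) (fun _ : ℝ => (⊤ : ENNReal))) N L ≤ ENNReal.ofReal K * Literature.MathematicalPhysics.QuantumManyBody.BoseGas.condensateNumber (Set.indicator (Set.Iic 1) (fun _ : ℝ => (⊤ : ENNReal))) N (L / a) := by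
  obtain ⟨N₀, η₀, c, hη₀, hc, hBEC⟩ := h
  refine ⟨1 / 4, 1 / 2, by norm_num, by norm_num, by norm_num, fun a hlo hhi => ?_⟩
  have ha : 0 < a := lt_trans (by norm_num) hlo
  have ha1 : a < 1 := hhi.trans (by norm_num)
  refine ⟨max N₀ 1, η₀, 1 / c, hη₀, by positivity, fun N L hN hNL => ?_⟩
  have hN₀ : N₀ ≤ N := le_of_max_le_left hN
  have hN1 : 1 ≤ N := le_of_max_le_right hN
  have hNpos : (0 : ℝ) < N := by exact_mod_cast hN1
  -- the window forces `L > 0`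
  have hL : 0 < L := by
    refine lt_of_not_ge fun hL => ?_
    have h3 : L ^ 3 ≤ 0 := by
      have : L ^ 3 = L * L ^ 2 := by ring
      rw [this]
      exact mul_nonpos_of_nonpos_of_nonneg hL (sq_nonneg L)
    have : (N : ℝ) ≤ 0 := hNL.trans (mul_nonpos_of_nonneg_of_nonpos hη₀.le h3)
    linarith
  -- the bigger box is dilute as well
  have hLa : L ≤ L / a := by
    rw [le_div_iff₀ ha]
    nlinarith
  have hNLa : (N : ℝ) ≤ η₀ * (L / a) ^ 3 :=
    hNL.trans (mul_le_mul_of_nonneg_left (pow_le_pow_left₀ hL.le hLa 3) hη₀.le)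
  haveI : Nonempty (TrialState N L) := TrialState.nonempty hN1 hL
  calc condensateNumber (Set.indicator (Set.Iic 1) (fun _ : ℝ => (⊤ : ENNReal))) N L
      ≤ (N : ℝ≥0∞) := Cruxes.HardCoreDominates.Birth.condensateNumber_le_card _ N L
    _ = ENNReal.ofReal (1 / c) * ENNReal.ofReal (c * N) := by
        rw [← ENNReal.ofReal_mul (by positivity), ← ENNReal.ofReal_natCast]
        congr 1
        field_simp
    _ ≤ ENNReal.ofReal (1 / c) *
          condensateNumber (Set.indicator (Set.Iic 1) (fun _ : ℝ => (⊤ : ENNReal))) N (L / a) :=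
        mul_le_mul' le_rfl (hBEC N (L / a) hN₀ hNLa)

/-- **S2' from the Dini-form covariance sign of crux 11884's line** (its one open stub
`stub_diniSign`, quantified exactly as registered there): the sign gives `HardCoreDominates`
(`Cruxes.HardCoreDominates.Birth.hardCoreDominates_of_diniSign`), whose hard-sphere instances give
per-ratio retention (`perRatioRetention_of_hardCoreDominates`, p157278). [folklore] -/
theorem perRatioRetention_of_diniSign
    (h : ∀ (v : ℝ → ENNReal) (R : ℝ), Measurable v → 0 < R → (∀ r : ℝ, R < r → v r = 0) →
      ∃ η₀ : ℝ, 0 < η₀ ∧ ∀ (N : ℕ) (L : ℝ), (N : ℝ) * R ^ 3 ≤ η₀ * L ^ 3 →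
        ∀ (t : NNReal) (ε : NNReal), 0 < ε → ∃ h₀ : NNReal, 0 < h₀ ∧ ∀ h : NNReal, 0 < h → h ≤ h₀ →
          Literature.MathematicalPhysics.QuantumManyBody.BoseGas.condensateNumber
              (v + Set.indicator (Set.Iic R) (fun _ : ℝ => (((t + h : NNReal)) : ENNReal))) N L ≤
            Literature.MathematicalPhysics.QuantumManyBody.BoseGas.condensateNumber
              (v + Set.indicator (Set.Iic R) (fun _ : ℝ => (t : ENNReal))) N L + ((ε * h : NNReal) : ENNReal)) :
    ∃ lo hi : ℝ, 0 < lo ∧ lo < hi ∧ hi < 1 ∧ ∀ a : ℝ, lo < a → a < hi → ∃ (N₀ : ℕ) (η₀ K : ℝ), 0 < η₀ ∧ 0 < K ∧ ∀ (N : ℕ) (L : ℝ), N₀ ≤ N → (N : ℝ) ≤ η₀ * L ^ 3 → Literature.MathematicalPhysics.QuantumManyBody.BoseGas.condensateNumber (Set.indicator (Set.Iic 1) (fun _ : ℝ => (⊤ : ENNReal))) N L ≤ ENNReal.ofReal K * Literature.MathematicalPhysics.QuantumManyBody.BoseGas.condensateNumber (Set.indicator (Set.Iic 1) (fun _ : ℝ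 => (⊤ : ENNReal))) N (L / a) :=
  perRatioRetention_of_hardCoreDominates
    (Cruxes.HardCoreDominates.Birth.hardCoreDominates_of_diniSign h)

end Summit.AtomisticToContinuum.BoseEinsteinCondensation.Cruxes.HardSphereBEC

end
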